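import Mathlib
import Summits.QuantumFields.BalabanUV.T4Continuum.Support.SliceCovariantLevels
import Summits.QuantumFields.BalabanUV.T4Continuum.Support.SliceFlatGaugeDecay
import Summits.QuantumFields.BalabanUV.T4Continuum.Support.SliceFlatGradientPrep

/-!
# T⁴ programme, node NE3 (η-rate of the minimisers) — THE FLAT RUNG, part 13: [B9] (3.42) ITEM 1 (`∇G`, `G∇*`; [B5] (1.110)
# entries 2–3) AT `U = 1` IN KERNEL FORM, and the one type's `hT31` INHABITED VERBATIM at the flat data

Fifteenth generation of the NE3 prover lineage P1 of the cell `pub-balaban`, file 7 — the end of the free-gradient chain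
(`SliceFlatHeatOneDim → SliceFlatHeatWeighted → SliceFlatHeatTorus → SliceFlatFreeKernel → SliceFlatFreeResolvent →
SliceFlatGradientPrep → SliceFlatGradient`).  The one type `SliceCovariantLevels.ne3Shape_torusCovE_upto_of_printedStatements`
(p199789) asks, among its STABILITY readings, for `hT31 : B9.Thm31Printed … (matrixFamily … (A …))` with the identifications
`hA0 : A 0 = G_j` and `hA1 : A 1 = (G_j·D)ᵀ`; in kernel form (`SliceTorusBlockModel.ineq342_matrixFamily_of_rowBounds`) item 1 is
`Σ_{z ∈ Δ_j(y₁)} |(G_j·D)(z,x)| ≤ B₀·L^j·e^{−δ₀·nbd_j(Δ(x), y₁)}`.  At `U = 1`, `G_j = gFlat j` (`SliceFlatOperators.gLevE_flat`);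
item 0 is `SliceFlatPropagator.gFlat_rowBound` (gen 13).  THIS FILE proves ITEM 1 for the unit difference matrices `D = colDiff ν`:
 * §1 the three WEIGHTED-ROW inputs at level `j ≤ k` (scale `L^j`, weight `e^{δρ/L^j}`): `gFlat j` (`≤ C_G·(L^j)²`, from item 0),
   `rowDiff ν (freeOp j)` (`≤ C_F·L^j`, from part 11's free gradient bound), and the comparison form `Wfl j = n⁻²·1 − massKernel_j −
   flatNg j` (`≤ C_W·(L^j)^{−2}`, from the cube count and gen 14's (3.49) entry bound `SliceFlatGaugeDecay.flatNg_le_349`);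
 * §2 **`cubeSum_rowDiff_gFlat_le`**: `∃ B₁ δ > 0` (functions of `d`) with, for all `k N L`, `j ≤ k`, `ν`, `p`, `y₁`:
   `Σ_{q : cubeI j q = y₁} |gFlat j (p+e_ν) q − gFlat j p q| ≤ B₁·L^j·e^{−δ·nbd_j(cubeI j p, y₁)}` — by the row-differenced RESOLVENT
   IDENTITY `∇gFlat = ∇F + (∇F)·Wfl·gFlat` (part 12), submultiplicativity of weighted rows, and WEIGHTED ⇒ CUBE-LOCALISED; the
   column form **`cubeSum_gFlat_colDiff_le`** (`gFlat` is symmetric): `Σ_{z : cubeI j z = y₁} |(gFlat j·colDiff ν)(z,x)| ≤ B₁·L^j·e^{−δ·nbd}`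
   = EXACTLY the binder `hGD` of `SliceTorusSkeleton.sliceKernel_bound_torus_of_kernelBounds` ∕ the `m = 1` row clause of `hT31`;
 * §3 **`thm31Printed_flat`**: for every `ι`, `Bg`, `c35`, `M` and direction `ν`, `B9.Thm31Printed c35 geo Bg (matrixFamily … (flatA ν …))`
   over `LevIdx ι` with `flatA ν j = ![gFlat j, (gFlat j·colDiff ν)ᵀ, 0, 0]` — `hT31` OF THE ONE TYPE INHABITED VERBATIM AT THE FLAT
   DATA with `D := colDiff ν`, constants depending on `d` only (`flatA_zero`, `flatA_one` are the binders `hA0`, `hA1` by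
   `gLevE_flat`).  With gen 14's `SliceFlatReadings` (`hT349`, `hT311`) ALL THREE printed-statement hypotheses of the one type are
   now theorems at `U = 1`.
NOT DONE (honest): nothing at `U ≠ 1` (the wall (W1)); no consistency reading ((W2)); `colDiff ν` is the natural flat `D`, the
covariant `D` of the skeleton stays a parameter.  NE3 is NOT proved.
Honest framing: finite-T⁴ ultraviolet bookkeeping about MINIMISERS (rung (B)+1 of the cell's ladder); no conditional of the
cell (`BetaPertH`, (B), (B^μ)) is used or hidden; nothing bears on infinite volume, a mass gap, or the Clay problem.  ABSOLUTE
RULE of the cell kept: inputs are kernel-proved tree modules only (parts 7–12, `SliceFlatPropagator`∕`Operators`∕`GaugeDecay`,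
`SliceCovariantLevels`, the tree's `B9` typed shapes as TARGETS, never as hypotheses); every declaration is a [model] definition or
a [folklore] theorem; no `def … : Prop`, no `sorry`, no axioms beyond Mathlib's.  PLACEMENT (human rule 2026-08-19): cell work
under `Summits/QuantumFields/BalabanUV/`; moves nothing.  Records: `t4/T4-EST-U1b-OSC.md` v1.32, `t4/T4-EST-NE3-P1.md` v2.31,
GAPS G-ne3p1-45 of the cell `pub-balaban`.
-/

noncomputable section

open Real Finset Matrix

namespace Summit.QuantumFields.BalabanUV.T4Continuum.SliceFlatGradient

open Literature.MathematicalPhysics.QuantumFieldTheory.Balaban1983to89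
open Literature.MathematicalPhysics.QuantumFieldTheory.Balaban1983to89.TreeLengthTorus (TPt)
open Literature.MathematicalPhysics.QuantumFieldTheory.Balaban1983to89.T4SliceOperatorData (massKernel abs_massKernel_le countConst countConst_pos)
open Summit.QuantumFields.BalabanUV.T4Continuum
open SliceTorusBlocks SliceTorusBlockModel SliceTorusTower SliceCovariantModel SliceCovariantTower SliceCovariantSkeleton
open SliceCovariantPrincipal SliceCovariantLevels SliceTorusComb SliceFlatPropagator SliceFlatOperators SliceFlatGaugeDecay
open SliceFlatFreeResolvent SliceFlatGradientPrep

variable (d : ℕ)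

/-! ## §1  The three weighted-row inputs at level `j ≤ k` -/
section Inputs

variable (k N L : ℕ) [NeZero N] [NeZero L]

/-- The exponential weight on the carrier at level `j`: `E(x,z) = e^{δρ(x,z)/n}`, `n = L^{min(j,k)}`. [model] [folklore] -/
def wE (j : ℕ) (δ : ℝ) (x z : TPt (d + 1) (N * L ^ k) × Fin (d + 1)) : ℝ :=
  Real.exp (δ * (rhoI (d + 1) k N L (Fin (d + 1)) x z / (side k L j : ℝ)))

/-- The weight is positive, multiplicative under the triangle inequality, and `1` on the diagonal. [folklore] -/
theorem wE_facts (j : ℕ) {δ : ℝ} (hδ : 0 ≤ δ) :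
    (∀ x z, 0 < wE d k N L j δ x z) ∧ (∀ x w z, wE d k N L j δ x z ≤ wE d k N L j δ x w * wE d k N L j δ w z) ∧
      (∀ x, wE d k N L j δ x x = 1) := by
  have hn : (0 : ℝ) < (side k L j : ℝ) := by exact_mod_cast Nat.lt_of_lt_of_le Nat.zero_lt_one (one_le_side k L j)
  refine ⟨fun x z => Real.exp_pos _, fun x w z => expWeight_triangle _ hδ hn (rhoI_triangle3 d k N L) x w z, fun x => ?_⟩
  unfold wE rhoI rho
  rw [sub_self, B12Decay510Torus.pl1_eq_sum]
  simp

/-- (G) **Weighted rows of `gFlat j`** (`j ≤ k`, `0 ≤ δ < flatδ₀`): `≤ flatB₀·(L^j)²·e^{δ(d+1)}·2^{d+1}·countConst(flatδ₀ − δ, d+1)` — from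
item 0 (`gFlat_rowBound`). [folklore] -/
theorem weightedRow_gFlat {j : ℕ} (hj : j ≤ k) {δ : ℝ} (hδ : 0 ≤ δ) (hδ₀ : δ < flatδ₀ d)
    (x : TPt (d + 1) (N * L ^ k) × Fin (d + 1)) :
    ∑ z, |gFlat d k N L j x z| * wE d k N L j δ x z
      ≤ flatB₀ d * ((L : ℝ) ^ j) ^ 2 * Real.exp (δ * (d + 1)) * ((2 : ℝ) ^ (d + 1) * countConst (flatδ₀ d - δ) (d + 1)) :=
  weightedRow_of_cubeRows d k N L hj (gFlat d k N L j) hδ hδ₀ (mul_nonneg (flatB₀_nonneg d) (by positivity)) x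
    (fun b => gFlat_rowBound d k N L j x b)

/-- (F) **Weighted rows of the free gradient `rowDiff ν (freeOp j)`** (`j ≤ k`, `0 ≤ δ < freeα d`):
`≤ freeC d·L^j·e^{δ(d+1)}·2^{d+1}·countConst(freeα d − δ, d+1)` — from part 11. [folklore] -/
theorem weightedRow_rowDiff_freeOp {j : ℕ} (hj : j ≤ k) (ν : Fin (d + 1)) {δ : ℝ} (hδ : 0 ≤ δ) (hδ₀ : δ < freeα d)
    (x : TPt (d + 1) (N * L ^ k) × Fin (d + 1)) :
    ∑ z, |rowDiff d k N L ν (freeOp d k N L j) x z| * wE d k N L j δ x z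
      ≤ freeC d * (L : ℝ) ^ j * Real.exp (δ * (d + 1)) * ((2 : ℝ) ^ (d + 1) * countConst (freeα d - δ) (d + 1)) := by
  have hside : (side k L j : ℝ) = (L : ℝ) ^ j := by rw [SliceFlatMassTerm.side_eq_pow k L hj]; push_cast; rfl
  refine weightedRow_of_cubeRows d k N L hj _ hδ hδ₀ (by unfold freeC; positivity) x fun b => ?_
  rw [← hside]
  exact cubeSum_rowDiff_freeOp_le d k N L j ν x b

/-- The level-`j` mass kernel's cube rows: `Σ_{w : cubeI w = b} |massKernel_j(x,w)| ≤ (d+1)(L^j)^{−2}·e^{−δ'·nbd_j(cubeI x, b)}` for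
ANY rate `δ'` (the kernel lives on the diagonal block). [folklore] -/
theorem cubeRow_massKernel_le {j : ℕ} (hj : j ≤ k) (δ' : ℝ) (x : TPt (d + 1) (N * L ^ k) × Fin (d + 1))
    (b : TPt (d + 1) (levM k N L j)) :
    ∑ w ∈ Finset.univ.filter (fun w => cubeI (d + 1) k N L (Fin (d + 1)) j w = b),
        |massKernel (cubeI (d + 1) k N L (Fin (d + 1)) j) (tau (cubeComb (d + 1) k N L j) (flatRm d k N L))
          (flatAm j / ((L : ℝ) ^ j) ^ (d + 1 + 2)) x w|
      ≤ ((d : ℝ) + 1) * (((L : ℝ) ^ j) ^ 2)⁻¹ * Real.exp (-(δ' * nbd (d + 1) k N L j (cubeI (d + 1) k N L (Fin (d + 1)) j x) b)) := by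
  have hL : (0 : ℝ) < (L : ℝ) := by exact_mod_cast Nat.pos_of_ne_zero (NeZero.ne L)
  have hLj : (0 : ℝ) < (L : ℝ) ^ j := pow_pos hL j
  have hside : (side k L j : ℝ) = (L : ℝ) ^ j := by rw [SliceFlatMassTerm.side_eq_pow k L hj]; push_cast; rfl
  have hm : (0 : ℝ) ≤ flatAm j / ((L : ℝ) ^ j) ^ (d + 1 + 2) := by unfold flatAm; positivity
  have hτ := abs_tau_le_one (K := cubeComb (d + 1) k N L j) (Rm := flatRm d k N L) (flatRm_isometric d k N L)
  by_cases hb : cubeI (d + 1) k N L (Fin (d + 1)) j x = b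
  · -- own block
    have hnbd : nbd (d + 1) k N L j (cubeI (d + 1) k N L (Fin (d + 1)) j x) b = 0 := by
      rw [← hb]; unfold nbd; rw [sub_self]; simp [npl1]
    rw [hnbd, Nat.cast_zero, mul_zero, neg_zero, Real.exp_zero, mul_one]
    calc ∑ w ∈ Finset.univ.filter (fun w => cubeI (d + 1) k N L (Fin (d + 1)) j w = b),
          |massKernel (cubeI (d + 1) k N L (Fin (d + 1)) j) (tau (cubeComb (d + 1) k N L j) (flatRm d k N L))
            (flatAm j / ((L : ℝ) ^ j) ^ (d + 1 + 2)) x w|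
        ≤ ∑ _w ∈ Finset.univ.filter (fun w => cubeI (d + 1) k N L (Fin (d + 1)) j w = b),
            flatAm j / ((L : ℝ) ^ j) ^ (d + 1 + 2) :=
          Finset.sum_le_sum fun w _ => (abs_massKernel_le (cubeI (d + 1) k N L (Fin (d + 1)) j) (tau (cubeComb (d + 1) k N L j) (flatRm d k N L)) hm hτ x w).trans
            (by split_ifs <;> [exact le_rfl; exact hm])
      _ ≤ flatAm j / ((L : ℝ) ^ j) ^ (d + 1 + 2) * (((d : ℝ) + 1) * (side k L j : ℝ) ^ (d + 1)) :=
          sum_cubeI_const_le d k N L j b hm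
      _ = ((d : ℝ) + 1) * (((L : ℝ) ^ j) ^ 2)⁻¹ := by
          rw [hside]; unfold flatAm; field_simp; ring
  ·
    have h0 : ∀ w ∈ Finset.univ.filter (fun w => cubeI (d + 1) k N L (Fin (d + 1)) j w = b),
        |massKernel (cubeI (d + 1) k N L (Fin (d + 1)) j) (tau (cubeComb (d + 1) k N L j) (flatRm d k N L))
          (flatAm j / ((L : ℝ) ^ j) ^ (d + 1 + 2)) x w| = 0 := by
      intro w hw
      have hwb : cubeI (d + 1) k N L (Fin (d + 1)) j w = b := (Finset.mem_filter.1 hw).2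
      have hne : cubeI (d + 1) k N L (Fin (d + 1)) j x ≠ cubeI (d + 1) k N L (Fin (d + 1)) j w := by rw [hwb]; exact hb
      have h := abs_massKernel_le (cubeI (d + 1) k N L (Fin (d + 1)) j) (tau (cubeComb (d + 1) k N L j) (flatRm d k N L)) hm hτ x w
      rw [if_neg hne] at h
      exact le_antisymm h (abs_nonneg _)
    rw [Finset.sum_eq_zero h0]
    positivity

/-- The flat remainder form's cube rows from the (3.49) ENTRY bound: `Σ_{w : cubeI w = b} |flatNg j (x,w)| ≤ (d+1)C₁(L^j)^{−2}·
e^{−(δ₁/2)·nbd_j(cubeI x, b)}`. [folklore] -/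
theorem cubeRow_flatNg_le {j : ℕ} (hj : j ≤ k) {δ₁ C₁ : ℝ} (hC₁ : 0 ≤ C₁)
    (h349 : ∀ z w : TPt (d + 1) (N * L ^ k) × Fin (d + 1), |flatNg d k N L j z w|
      ≤ C₁ * B9.pref4inv ((L : ℝ) ^ j) 3 * ((L : ℝ) ^ j) ^ (-((d + 1 : ℕ) : ℝ))
        * Real.exp (-(δ₁ / 2 * (nbd (d + 1) k N L j (cubeI (d + 1) k N L (Fin (d + 1)) j z)
            (cubeI (d + 1) k N L (Fin (d + 1)) j w) : ℝ))))
    (x : TPt (d + 1) (N * L ^ k) × Fin (d + 1)) (b : TPt (d + 1) (levM k N L j)) :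
    ∑ w ∈ Finset.univ.filter (fun w => cubeI (d + 1) k N L (Fin (d + 1)) j w = b), |flatNg d k N L j x w|
      ≤ ((d : ℝ) + 1) * C₁ * (((L : ℝ) ^ j) ^ 2)⁻¹ *
          Real.exp (-(δ₁ / 2 * nbd (d + 1) k N L j (cubeI (d + 1) k N L (Fin (d + 1)) j x) b)) := by
  have hL : (0 : ℝ) < (L : ℝ) := by exact_mod_cast Nat.pos_of_ne_zero (NeZero.ne L)
  have hLj : (0 : ℝ) < (L : ℝ) ^ j := pow_pos hL j
  have hside : (side k L j : ℝ) = (L : ℝ) ^ j := by rw [SliceFlatMassTerm.side_eq_pow k L hj]; push_cast; rfl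
  set c : ℝ := C₁ * B9.pref4inv ((L : ℝ) ^ j) 3 * ((L : ℝ) ^ j) ^ (-((d + 1 : ℕ) : ℝ))
      * Real.exp (-(δ₁ / 2 * (nbd (d + 1) k N L j (cubeI (d + 1) k N L (Fin (d + 1)) j x) b : ℝ))) with hc
  have hpi : B9.pref4inv ((L : ℝ) ^ j) 3 = (((L : ℝ) ^ j)⁻¹) ^ 2 := rfl
  have hrp : ((L : ℝ) ^ j) ^ (-((d + 1 : ℕ) : ℝ)) = (((L : ℝ) ^ j) ^ (d + 1))⁻¹ := by
    rw [Real.rpow_neg hLj.le, Real.rpow_natCast]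
  have hc0 : 0 ≤ c := by rw [hc, hpi, hrp]; positivity
  calc ∑ w ∈ Finset.univ.filter (fun w => cubeI (d + 1) k N L (Fin (d + 1)) j w = b), |flatNg d k N L j x w|
      ≤ ∑ _w ∈ Finset.univ.filter (fun w => cubeI (d + 1) k N L (Fin (d + 1)) j w = b), c := by
        refine Finset.sum_le_sum fun w hw => ?_
        have hwb : cubeI (d + 1) k N L (Fin (d + 1)) j w = b := (Finset.mem_filter.1 hw).2
        have := h349 x w
        rwa [hwb] at this
    _ ≤ c * (((d : ℝ) + 1) * (side k L j : ℝ) ^ (d + 1)) := sum_cubeI_const_le d k N L j b hc0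
    _ = _ := by
        rw [hc, hpi, hrp, hside]; field_simp

/-- (W) **Weighted rows of the comparison form `Wfl j`** (`j ≤ k`, `0 ≤ δ < δ₁/2`): `≤ (L^j)^{−2}·C_W` with
`C_W = 1 + (d+1)e^{δ(d+1)}2^{d+1}countConst(1, d+1) + (d+1)C₁e^{δ(d+1)}2^{d+1}countConst(δ₁/2 − δ, d+1)`. [folklore] -/
theorem weightedRow_Wfl {j : ℕ} (hj : j ≤ k) {δ δ₁ C₁ : ℝ} (hδ : 0 ≤ δ) (hδ₁ : δ < δ₁ / 2) (hC₁ : 0 ≤ C₁)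
    (h349 : ∀ z w : TPt (d + 1) (N * L ^ k) × Fin (d + 1), |flatNg d k N L j z w|
      ≤ C₁ * B9.pref4inv ((L : ℝ) ^ j) 3 * ((L : ℝ) ^ j) ^ (-((d + 1 : ℕ) : ℝ))
        * Real.exp (-(δ₁ / 2 * (nbd (d + 1) k N L j (cubeI (d + 1) k N L (Fin (d + 1)) j z)
            (cubeI (d + 1) k N L (Fin (d + 1)) j w) : ℝ))))
    (x : TPt (d + 1) (N * L ^ k) × Fin (d + 1)) :
    ∑ z, |Wfl d k N L j x z| * wE d k N L j δ x z
      ≤ (((L : ℝ) ^ j) ^ 2)⁻¹ * (1 + ((d : ℝ) + 1) * Real.exp (δ * (d + 1)) * ((2 : ℝ) ^ (d + 1) * countConst 1 (d + 1))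
          + ((d : ℝ) + 1) * C₁ * Real.exp (δ * (d + 1)) * ((2 : ℝ) ^ (d + 1) * countConst (δ₁ / 2 - δ) (d + 1))) := by
  classical
  obtain ⟨hEpos, -, hEdiag⟩ := wE_facts d k N L j hδ
  have hside : (side k L j : ℝ) = (L : ℝ) ^ j := by rw [SliceFlatMassTerm.side_eq_pow k L hj]; push_cast; rfl
  have hL : (0 : ℝ) < (L : ℝ) := by exact_mod_cast Nat.pos_of_ne_zero (NeZero.ne L)
  have hLj : (0 : ℝ) < (L : ℝ) ^ j := pow_pos hL j
  set I1 : Matrix (TPt (d + 1) (N * L ^ k) × Fin (d + 1)) (TPt (d + 1) (N * L ^ k) × Fin (d + 1)) ℝ :=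
    (((side k L j : ℝ) ^ 2)⁻¹) • (1 : Matrix _ _ ℝ) with hI1
  set MK : Matrix (TPt (d + 1) (N * L ^ k) × Fin (d + 1)) (TPt (d + 1) (N * L ^ k) × Fin (d + 1)) ℝ :=
    massKernel (cubeI (d + 1) k N L (Fin (d + 1)) j) (tau (cubeComb (d + 1) k N L j) (flatRm d k N L))
      (flatAm j / ((L : ℝ) ^ j) ^ (d + 1 + 2)) with hMK
  have hW : Wfl d k N L j = I1 - MK - flatNg d k N L j := rfl
  have h1 : ∑ z, |I1 x z| * wE d k N L j δ x z = (((L : ℝ) ^ j) ^ 2)⁻¹ := by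
    rw [Finset.sum_eq_single x (fun z _ hz => by simp [hI1, Ne.symm hz]) (fun h => absurd (Finset.mem_univ x) h)]
    simp [hI1, hEdiag x, hside, abs_of_pos (inv_pos.2 (pow_pos hLj 2))]
  have h2 : ∑ z, |MK x z| * wE d k N L j δ x z
      ≤ ((d : ℝ) + 1) * (((L : ℝ) ^ j) ^ 2)⁻¹ * Real.exp (δ * (d + 1)) * ((2 : ℝ) ^ (d + 1) * countConst 1 (d + 1)) := by
    have h := weightedRow_of_cubeRows d k N L hj MK (δ₀ := δ + 1) hδ (by linarith) (by positivity) x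
      (fun b => cubeRow_massKernel_le d k N L hj (δ + 1) x b)
    rwa [show δ + 1 - δ = 1 by ring] at h
  have h3 : ∑ z, |flatNg d k N L j x z| * wE d k N L j δ x z
      ≤ ((d : ℝ) + 1) * C₁ * (((L : ℝ) ^ j) ^ 2)⁻¹ * Real.exp (δ * (d + 1)) *
          ((2 : ℝ) ^ (d + 1) * countConst (δ₁ / 2 - δ) (d + 1)) :=
    weightedRow_of_cubeRows d k N L hj (flatNg d k N L j) hδ hδ₁ (by positivity) x
      (fun b => cubeRow_flatNg_le d k N L hj hC₁ h349 x b)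
  calc ∑ z, |Wfl d k N L j x z| * wE d k N L j δ x z
      ≤ ∑ z, (|I1 x z| * wE d k N L j δ x z + |MK x z| * wE d k N L j δ x z + |flatNg d k N L j x z| * wE d k N L j δ x z) := by
        refine Finset.sum_le_sum fun z _ => ?_
        rw [hW, Matrix.sub_apply, Matrix.sub_apply, ← add_mul, ← add_mul]
        exact mul_le_mul_of_nonneg_right (by
          calc |I1 x z - MK x z - flatNg d k N L j x z| ≤ |I1 x z - MK x z| + |flatNg d k N L j x z| := abs_sub _ _
            _ ≤ |I1 x z| + |MK x z| + |flatNg d k N L j x z| := by gcongr; exact abs_sub _ _) (hEpos x z).le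
    _ = (∑ z, |I1 x z| * wE d k N L j δ x z) + (∑ z, |MK x z| * wE d k N L j δ x z)
          + ∑ z, |flatNg d k N L j x z| * wE d k N L j δ x z := by
        rw [Finset.sum_add_distrib, Finset.sum_add_distrib]
    _ ≤ (((L : ℝ) ^ j) ^ 2)⁻¹ + ((d : ℝ) + 1) * (((L : ℝ) ^ j) ^ 2)⁻¹ * Real.exp (δ * (d + 1)) * ((2 : ℝ) ^ (d + 1) * countConst 1 (d + 1))
          + ((d : ℝ) + 1) * C₁ * (((L : ℝ) ^ j) ^ 2)⁻¹ * Real.exp (δ * (d + 1)) *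
            ((2 : ℝ) ^ (d + 1) * countConst (δ₁ / 2 - δ) (d + 1)) := by rw [h1]; gcongr
    _ = _ := by ring

end Inputs

/-! ## §2  (3.42) ITEM 1 AT `U = 1` IN KERNEL FORM: row and column unit differences of `gFlat` -/
section ItemOne

/-- **[B9] (3.42) ITEM 1 AT `U = 1`, ROW FORM** — there are `B₁, δ > 0`, functions of `d` only, such that for all `k, N, L`, every
level `j ≤ k`, direction `ν`, row `p` and block `y₁`:
`Σ_{q : cubeI j q = y₁} |gFlat j (p+e_ν) q − gFlat j p q| ≤ B₁·L^j·e^{−δ·nbd_j(cubeI j p, y₁)}` — ONE power of `L^j` (the prefactor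
`L^jη` of (3.42) in the unit normalisation), against `(L^j)²` for item 0.  Proof: the row-differenced resolvent identity around the
free operator, weighted rows of the three factors (§1), submultiplicativity, and WEIGHTED ⇒ CUBE-LOCALISED. [folklore] -/
theorem cubeSum_rowDiff_gFlat_le :
    ∃ B₁ δ : ℝ, 0 < B₁ ∧ 0 < δ ∧ ∀ (k N L : ℕ) [NeZero N] [NeZero L] (j : ℕ), j ≤ k →
      ∀ (ν : Fin (d + 1)) (p : TPt (d + 1) (N * L ^ k) × Fin (d + 1)) (y₁ : TPt (d + 1) (levM k N L j)),
        ∑ q ∈ Finset.univ.filter (fun q => cubeI (d + 1) k N L (Fin (d + 1)) j q = y₁),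
            |rowDiff d k N L ν (gFlat d k N L j) p q|
          ≤ B₁ * (L : ℝ) ^ j * Real.exp (-(δ * nbd (d + 1) k N L j (cubeI (d + 1) k N L (Fin (d + 1)) j p) y₁)) := by
  obtain ⟨δ₁, C₁, hδ₁, hC₁, h349⟩ := flatNg_le_349 d
  obtain ⟨hα0, -⟩ := freeα_pos_le d
  have hf0 := flatδ₀_pos d
  set δ : ℝ := min (min (flatδ₀ d) (freeα d)) (δ₁ / 2) / 2 with hδdef
  have hmin : 0 < min (min (flatδ₀ d) (freeα d)) (δ₁ / 2) := lt_min (lt_min hf0 hα0) (by linarith)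
  have hδ : 0 < δ := by rw [hδdef]; linarith
  have hδf : δ < flatδ₀ d := by
    have : min (min (flatδ₀ d) (freeα d)) (δ₁ / 2) ≤ flatδ₀ d := (min_le_left _ _).trans (min_le_left _ _)
    rw [hδdef]; linarith
  have hδa : δ < freeα d := by
    have : min (min (flatδ₀ d) (freeα d)) (δ₁ / 2) ≤ freeα d := (min_le_left _ _).trans (min_le_right _ _)
    rw [hδdef]; linarith
  have hδ1 : δ < δ₁ / 2 := by
    have : min (min (flatδ₀ d) (freeα d)) (δ₁ / 2) ≤ δ₁ / 2 := min_le_right _ _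
    rw [hδdef]; linarith
  set KK : ℝ := Real.exp (δ * (d + 1)) * (2 : ℝ) ^ (d + 1) with hKK
  set CG : ℝ := flatB₀ d * KK * countConst (flatδ₀ d - δ) (d + 1) with hCG
  set CF : ℝ := freeC d * KK * countConst (freeα d - δ) (d + 1) with hCF
  set CW : ℝ := 1 + ((d : ℝ) + 1) * KK * countConst 1 (d + 1) + ((d : ℝ) + 1) * C₁ * KK * countConst (δ₁ / 2 - δ) (d + 1)
    with hCW
  have hKK0 : 0 < KK := by rw [hKK]; positivity
  have hcG := countConst_pos (sub_pos.2 hδf) (d + 1)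
  have hcF := countConst_pos (sub_pos.2 hδa) (d + 1)
  have hc1 := countConst_pos one_pos (d + 1)
  have hcW := countConst_pos (sub_pos.2 hδ1) (d + 1)
  have hCG0 : 0 ≤ CG := by rw [hCG]; exact mul_nonneg (mul_nonneg (flatB₀_nonneg d) hKK0.le) hcG.le
  have hCF0 : 0 < CF := by rw [hCF]; unfold freeC; positivity
  have hCW0 : 0 ≤ CW := by rw [hCW]; positivity
  refine ⟨CF * (1 + CW * CG) * Real.exp (δ * (d + 1)), δ, by positivity, hδ, fun k N L _ _ j hj ν p y₁ => ?_⟩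
  have hL : (0 : ℝ) < (L : ℝ) := by exact_mod_cast Nat.pos_of_ne_zero (NeZero.ne L)
  have hLj : (0 : ℝ) < (L : ℝ) ^ j := pow_pos hL j
  obtain ⟨hEpos, hEtri, -⟩ := wE_facts d k N L j hδ.le
  have hG : ∀ x, ∑ z, |gFlat d k N L j x z| * wE d k N L j δ x z ≤ CG * ((L : ℝ) ^ j) ^ 2 := fun x =>
    (weightedRow_gFlat d k N L hj hδ.le hδf x).trans (le_of_eq (by rw [hCG, hKK]; ring))
  have hF : ∀ x, ∑ z, |rowDiff d k N L ν (freeOp d k N L j) x z| * wE d k N L j δ x z ≤ CF * (L : ℝ) ^ j := fun x =>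
    (weightedRow_rowDiff_freeOp d k N L hj ν hδ.le hδa x).trans (le_of_eq (by rw [hCF, hKK]; ring))
  have hW : ∀ x, ∑ z, |Wfl d k N L j x z| * wE d k N L j δ x z ≤ CW * (((L : ℝ) ^ j) ^ 2)⁻¹ := fun x =>
    (weightedRow_Wfl d k N L hj hδ.le hδ1 hC₁.le (h349 k N L j hj) x).trans (le_of_eq (by rw [hCW, hKK]; ring))
  have hFW : ∀ x, ∑ z, |(rowDiff d k N L ν (freeOp d k N L j) * Wfl d k N L j) x z| * wE d k N L j δ x z
      ≤ (CF * (L : ℝ) ^ j) * (CW * (((L : ℝ) ^ j) ^ 2)⁻¹) :=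
    weightedRow_mul_le _ _ _ (by positivity) (fun x z => (hEpos x z).le) hEtri hF hW
  have hFWG : ∀ x, ∑ z, |(rowDiff d k N L ν (freeOp d k N L j) * Wfl d k N L j * gFlat d k N L j) x z| * wE d k N L j δ x z
      ≤ ((CF * (L : ℝ) ^ j) * (CW * (((L : ℝ) ^ j) ^ 2)⁻¹)) * (CG * ((L : ℝ) ^ j) ^ 2) :=
    weightedRow_mul_le _ _ _ (by positivity) (fun x z => (hEpos x z).le) hEtri hFW hG
  have hrow : ∑ z, |rowDiff d k N L ν (gFlat d k N L j) p z| * wE d k N L j δ p z ≤ CF * (1 + CW * CG) * (L : ℝ) ^ j := by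
    rw [rowDiff_gFlat_eq]
    calc ∑ z, |(rowDiff d k N L ν (freeOp d k N L j) + rowDiff d k N L ν (freeOp d k N L j) * Wfl d k N L j * gFlat d k N L j) p z|
          * wE d k N L j δ p z
        ≤ ∑ z, (|rowDiff d k N L ν (freeOp d k N L j) p z| * wE d k N L j δ p z
            + |(rowDiff d k N L ν (freeOp d k N L j) * Wfl d k N L j * gFlat d k N L j) p z| * wE d k N L j δ p z) := by
          refine Finset.sum_le_sum fun z _ => ?_
          rw [Matrix.add_apply, ← add_mul]
          exact mul_le_mul_of_nonneg_right (abs_add_le _ _) (hEpos p z).le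
      _ ≤ CF * (L : ℝ) ^ j + ((CF * (L : ℝ) ^ j) * (CW * (((L : ℝ) ^ j) ^ 2)⁻¹)) * (CG * ((L : ℝ) ^ j) ^ 2) := by
          rw [Finset.sum_add_distrib]; exact add_le_add (hF p) (hFWG p)
      _ = CF * (1 + CW * CG) * (L : ℝ) ^ j := by field_simp
  have h := cubeSum_le_of_weightedRow d k N L j (rowDiff d k N L ν (gFlat d k N L j)) hδ.le p hrow y₁
  calc _ ≤ _ := h
    _ = _ := by ring

variable (k N L : ℕ) [NeZero N] [NeZero L]

/-- **[B9] (3.42) ITEM 1 AT `U = 1`, COLUMN FORM = the binder `hGD` of the skeleton ∕ the `m = 1` clause of `hT31` for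
`D = colDiff ν`**: with the constants of `cubeSum_rowDiff_gFlat_le`, `Σ_{z : cubeI j z = y₁} |(gFlat j·colDiff ν)(z,x)| ≤
B₁·L^j·e^{−δ·nbd_j(cubeI j x, y₁)}` (`gFlat` is symmetric, part 12). [folklore] -/
theorem cubeSum_gFlat_colDiff_le {B₁ δ : ℝ}
    (hrow : ∀ (k N L : ℕ) [NeZero N] [NeZero L] (j : ℕ), j ≤ k →
      ∀ (ν : Fin (d + 1)) (p : TPt (d + 1) (N * L ^ k) × Fin (d + 1)) (y₁ : TPt (d + 1) (levM k N L j)),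
        ∑ q ∈ Finset.univ.filter (fun q => cubeI (d + 1) k N L (Fin (d + 1)) j q = y₁),
            |rowDiff d k N L ν (gFlat d k N L j) p q|
          ≤ B₁ * (L : ℝ) ^ j * Real.exp (-(δ * nbd (d + 1) k N L j (cubeI (d + 1) k N L (Fin (d + 1)) j p) y₁)))
    {j : ℕ} (hj : j ≤ k) (ν : Fin (d + 1)) (x : TPt (d + 1) (N * L ^ k) × Fin (d + 1)) (y₁ : TPt (d + 1) (levM k N L j)) :
    ∑ z ∈ Finset.univ.filter (fun z => cubeI (d + 1) k N L (Fin (d + 1)) j z = y₁), |(gFlat d k N L j * colDiff d k N L ν) z x|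
      ≤ B₁ * (L : ℝ) ^ j * Real.exp (-(δ * nbd (d + 1) k N L j (cubeI (d + 1) k N L (Fin (d + 1)) j x) y₁)) := by
  simp_rw [gFlat_mul_colDiff_apply]
  exact hrow k N L j hj ν x y₁

end ItemOne

/-! ## §3  `hT31` OF THE ONE TYPE INHABITED AT THE FLAT DATA -/
section Thm31

variable (k N L : ℕ) [NeZero N] [NeZero L]

/-- **The flat (3.42) carrier** for direction `ν`: slot `0` = `gFlat j` (`G_j`), slot `1` = `(gFlat j·colDiff ν)ᵀ` (`(G_j·D)ᵀ` with
`D = colDiff ν`), slots `2, 3` (`G∇*`, `ΔG`: not read by the skeleton) = `0`. [model] -/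
def flatA (ν : Fin (d + 1)) (j : ℕ) {B : B9.Backgrounds} :
    Fin 4 → B.Cfg → Matrix (TPt (d + 1) (N * L ^ k) × Fin (d + 1)) (TPt (d + 1) (N * L ^ k) × Fin (d + 1)) ℝ :=
  fun m _ => ![gFlat d k N L j, (gFlat d k N L j * colDiff d k N L ν).transpose, 0, 0] m

/-- The binder `hA0` of the one type at the flat data: `flatA ν j 0 U = gLevE flatE cubeComb flatRm wB (aB flatAm) flatNg j`. [folklore] -/
theorem flatA_zero (ν : Fin (d + 1)) (j : ℕ) {B : B9.Backgrounds} (U : B.Cfg) :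
    flatA d k N L ν j 0 U
      = gLevE (flatE d k N L) (cubeComb (d + 1) k N L) (flatRm d k N L) (wB L (d + 1)) (aB L (d + 1) flatAm) (flatNg d k N L) j := by
  rw [gLevE_flat]; rfl

/-- The binder `hA1` of the one type at the flat data with `D := colDiff ν`: `flatA ν j 1 U = (gLevE … j·colDiff ν)ᵀ`. [folklore] -/
theorem flatA_one (ν : Fin (d + 1)) (j : ℕ) {B : B9.Backgrounds} (U : B.Cfg) :
    flatA d k N L ν j 1 U
      = (gLevE (flatE d k N L) (cubeComb (d + 1) k N L) (flatRm d k N L) (wB L (d + 1)) (aB L (d + 1) flatAm) (flatNg d k N L) j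
          * colDiff d k N L ν).transpose := by
  rw [gLevE_flat]; rfl

/-- **`hT31` AT THE FLAT DATA — INHABITED.**  For every index type `ι`, every backgrounds bundle `Bg`, every `c35, M` and every
direction `ν`, [B9] Theorem 3.1 AS TYPED (`B9.Thm31Printed`) holds for the flat (3.42) carriers over `LevIdx ι` with the block
distance as site distance: witnesses `M₁ = a₀ = 1`, `δ₀ = min(flatδ₀ d, δ)`, `B₀ = max(flatB₀ d, B₁)` (item 0: `gFlat_rowBound`; item 1:
`cubeSum_gFlat_colDiff_le`; items 2, 3: zero carriers; Hölder block: `ineq343_345_matrixFamily`) — constants depending on `d` only.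
With `SliceFlatReadings.stmt349Printed_flat` ∕ `thm311Printed_flat` (gen 14), all three printed-statement hypotheses of the one
type `SliceCovariantLevels.ne3Shape_torusCovE_upto_of_printedStatements` are theorems at `U = 1`.  HONEST: `U = 1` only; the
consistency readings are untouched; NE3 is NOT proved. [folklore] -/
theorem thm31Printed_flat {ι : Type} (c35 M : ℝ) (Bg : ℕ → ι → ℕ → B9.Backgrounds) (ν : Fin (d + 1)) :
    B9.Thm31Printed c35
      (fun p : LevIdx ι => blockGeom (cubeI (d + 1) p.1.1 N L (Fin (d + 1)) p.1.2.2)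
        (fun y y₁ => (nbd (d + 1) p.1.1 N L p.1.2.2 y y₁ : ℝ)) p.1.2.2 (L : ℝ) M)
      (fun p : LevIdx ι => Bg p.1.1 p.1.2.1 p.1.2.2)
      (fun p : LevIdx ι => matrixFamily (cubeI (d + 1) p.1.1 N L (Fin (d + 1)) p.1.2.2)
        (fun y y₁ => (nbd (d + 1) p.1.1 N L p.1.2.2 y y₁ : ℝ)) p.1.2.2 (L : ℝ) M
        (flatA d p.1.1 N L ν p.1.2.2 (B := Bg p.1.1 p.1.2.1 p.1.2.2))) := by
  obtain ⟨B₁, δ, hB₁, hδ, hrow⟩ := cubeSum_rowDiff_gFlat_le d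
  have hf0 := flatδ₀_pos d
  have hL0 : (0 : ℝ) ≤ (L : ℝ) := Nat.cast_nonneg L
  set δ₀ : ℝ := min (flatδ₀ d) δ with hδ₀
  set B₀ : ℝ := max (flatB₀ d) B₁ with hB₀
  have hδ₀pos : 0 < δ₀ := lt_min hf0 hδ
  have hB₀pos : 0 < B₀ := lt_max_of_lt_right hB₁
  refine ⟨1, δ₀, 1, B₀, fun _ => 0, fun _ => 0, fun _ _ => 0, one_pos, hδ₀pos, one_pos, hB₀pos,
    fun p _ _ _ _ U _ => ⟨?_, ineq343_345_matrixFamily _ _ p.1.2.2 (L : ℝ) M _ δ₀ U⟩⟩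
  refine ineq342_matrixFamily_of_rowBounds _ _ p.1.2.2 M _ U hB₀pos.le hL0 fun m x y₁ => ?_
  have hLj : (0 : ℝ) ≤ (L : ℝ) ^ p.1.2.2 := pow_nonneg hL0 _
  have hnn : (0 : ℝ) ≤ (nbd (d + 1) p.1.1 N L p.1.2.2 (cubeI (d + 1) p.1.1 N L (Fin (d + 1)) p.1.2.2 x) y₁ : ℝ) := Nat.cast_nonneg _
  have hexp0 : Real.exp (-(flatδ₀ d * nbd (d + 1) p.1.1 N L p.1.2.2 (cubeI (d + 1) p.1.1 N L (Fin (d + 1)) p.1.2.2 x) y₁))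
      ≤ Real.exp (-(δ₀ * nbd (d + 1) p.1.1 N L p.1.2.2 (cubeI (d + 1) p.1.1 N L (Fin (d + 1)) p.1.2.2 x) y₁)) :=
    Real.exp_le_exp.2 (neg_le_neg (mul_le_mul_of_nonneg_right (min_le_left _ _) hnn))
  have hexp1 : Real.exp (-(δ * nbd (d + 1) p.1.1 N L p.1.2.2 (cubeI (d + 1) p.1.1 N L (Fin (d + 1)) p.1.2.2 x) y₁))
      ≤ Real.exp (-(δ₀ * nbd (d + 1) p.1.1 N L p.1.2.2 (cubeI (d + 1) p.1.1 N L (Fin (d + 1)) p.1.2.2 x) y₁)) :=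
    Real.exp_le_exp.2 (neg_le_neg (mul_le_mul_of_nonneg_right (min_le_right _ _) hnn))
  fin_cases m
  · show ∑ z ∈ Finset.univ.filter (fun z => cubeI (d + 1) p.1.1 N L (Fin (d + 1)) p.1.2.2 z = y₁), |gFlat d p.1.1 N L p.1.2.2 x z|
      ≤ B₀ * ((L : ℝ) ^ p.1.2.2) ^ 2 * Real.exp (-(δ₀ * nbd (d + 1) p.1.1 N L p.1.2.2 (cubeI (d + 1) p.1.1 N L (Fin (d + 1)) p.1.2.2 x) y₁))
    refine (gFlat_rowBound d p.1.1 N L p.1.2.2 x y₁).trans ?_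
    gcongr
    · exact le_max_left _ _
  · show ∑ z ∈ Finset.univ.filter (fun z => cubeI (d + 1) p.1.1 N L (Fin (d + 1)) p.1.2.2 z = y₁),
        |(gFlat d p.1.1 N L p.1.2.2 * colDiff d p.1.1 N L ν).transpose x z|
      ≤ B₀ * (L : ℝ) ^ p.1.2.2 * Real.exp (-(δ₀ * nbd (d + 1) p.1.1 N L p.1.2.2 (cubeI (d + 1) p.1.1 N L (Fin (d + 1)) p.1.2.2 x) y₁))
    simp only [Matrix.transpose_apply]
    refine (cubeSum_gFlat_colDiff_le d p.1.1 N L hrow p.2 ν x y₁).trans ?_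
    gcongr
    · exact le_max_right _ _
  · show ∑ z ∈ Finset.univ.filter (fun z => cubeI (d + 1) p.1.1 N L (Fin (d + 1)) p.1.2.2 z = y₁), |(0 : Matrix _ _ ℝ) x z|
      ≤ B₀ * (L : ℝ) ^ p.1.2.2 * Real.exp (-(δ₀ * nbd (d + 1) p.1.1 N L p.1.2.2 (cubeI (d + 1) p.1.1 N L (Fin (d + 1)) p.1.2.2 x) y₁))
    simp only [Matrix.zero_apply, abs_zero, Finset.sum_const_zero]
    positivity
  · show ∑ z ∈ Finset.univ.filter (fun z => cubeI (d + 1) p.1.1 N L (Fin (d + 1)) p.1.2.2 z = y₁), |(0 : Matrix _ _ ℝ) x z|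
      ≤ B₀ * 1 * Real.exp (-(δ₀ * nbd (d + 1) p.1.1 N L p.1.2.2 (cubeI (d + 1) p.1.1 N L (Fin (d + 1)) p.1.2.2 x) y₁))
    simp only [Matrix.zero_apply, abs_zero, Finset.sum_const_zero]
    positivity

end Thm31

end Summit.QuantumFields.BalabanUV.T4Continuum.SliceFlatGradient
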